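import Mathlib
import Literature.Combinatorics.Additive.ArithmeticRemovalProofs
import Literature.Computability.AlgebraicComplexity.SimultaneousDoubleProduct

/-!
# Mass concentration — the removal lemma's full export (crux `PrimeDensityDecay`,
stmt-MatrixMultiplication-14311, line `collision-profile-removal`, stub `stub_massConcentration`)

For `n` pairs `(A i, B i)` of `s`-subsets of `ZMod p` with the simultaneous double product
property — (W) each `A i ⊕ B i` direct, (X) simultaneity — write `X = ⋃ A i`, `Y = ⋃ B i` and
`X₀ = ⋃ (A i - B i)` (the private differences).  By (X) ("faithfulness") the zero-sum triples
`x + y' + d' = 0` with `x ∈ X`, `y' ∈ -Y`, `d' ∈ -X₀` inject into the matched pairs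
`(x, -y') ∈ A i ×ˢ B i`, so there are at most `Σ |A i| |B i| = n s²` of them; since the `A i` are
pairwise disjoint (`n s ≤ p`) and `p ≥ s²` ((W)), `n s² ≤ p s ≤ δ p²` as soon as `s ≥ 1/δ`.
Green's arithmetic removal lemma (`Literature.Combinatorics.Additive.Green2005_1_5_holds`, `k = 3`)
then deletes `≤ η p` elements from each of `X`, `-Y`, `-X₀` and kills every zero-sum triple.  With
`R :=` the negatives of the deleted elements of `-X₀` (`R ⊆ X₀`, `|R| ≤ η p`), every matched pair
`(a, b) ∈ A i ×ˢ B i` has `a` deleted, or `-b` deleted, or `a - b ∈ R`; a deleted point lies in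
exactly `s` matched pairs (disjointness), so all but `2 η p s` of the `n s²` matched pairs have
their difference in `R`.
-/

set_option linter.dupNamespace false

namespace Summit.MatrixMultiplication.MatrixMultiplication.Theorems.PrimeDensityDecay.MassConcentration

open scoped BigOperators Pointwise

/-- **Faithfulness count.** Under simultaneity (X), the zero-sum triples of
`X ×ˢ (-Y) ×ˢ (-X₀)` (as `Fin 3`-tuples) inject, via `a ↦ (a 0, -a 1)`, into the matched pairs
`⋃ (A i ×ˢ B i)`: if `x ∈ A i`, `y ∈ B k` and `x - y = a' - b'` with `a' ∈ A j`, `b' ∈ B j`, then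
`(x - a') + (b' - y) = 0` and (X) gives `i = k`.  Hence there are at most `Σ |A i| |B i|` of
them. -/
theorem card_solutions_le {G : Type*} [AddCommGroup G] [DecidableEq G] {n : ℕ}
    (A B : Fin n → Finset G)
    (hX : ∀ i j k : Fin n, ∀ a ∈ A i, ∀ a' ∈ A j, ∀ b ∈ B j, ∀ b' ∈ B k,
      (a - a') + (b - b') = 0 → i = k) :
    ((Fintype.piFinset ![Finset.univ.biUnion A, -(Finset.univ.biUnion B),
        -(Finset.univ.biUnion fun i => A i - B i)]).filter fun a => ∑ j, a j = 0).card ≤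
      ∑ i, (A i).card * (B i).card := by
  refine (Finset.card_le_card_of_injOn (t := Finset.univ.biUnion fun i => A i ×ˢ B i)
    (fun a => (a 0, -a 1)) ?_ ?_).trans
    (Finset.card_biUnion_le.trans_eq (Finset.sum_congr rfl fun i _ => Finset.card_product _ _))
  · intro a ha
    obtain ⟨hmem, hsum⟩ := Finset.mem_filter.1 (Finset.mem_coe.1 ha)
    rw [Fintype.mem_piFinset] at hmem
    rw [Fin.sum_univ_three] at hsum
    have h0 : a 0 ∈ Finset.univ.biUnion A := hmem 0
    have h1 : a 1 ∈ -(Finset.univ.biUnion B) := hmem 1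
    have h2 : a 2 ∈ -(Finset.univ.biUnion fun i => A i - B i) := hmem 2
    rw [Finset.mem_neg', Finset.mem_biUnion] at h1 h2
    obtain ⟨i, -, hi⟩ := Finset.mem_biUnion.1 h0
    obtain ⟨k, -, hk⟩ := h1
    obtain ⟨j, -, hj⟩ := h2
    obtain ⟨a', ha', b', hb', he⟩ := Finset.mem_sub.1 hj
    have hik : i = k := hX i j k (a 0) hi a' ha' b' hb' (-a 1) hk (by
      calc a 0 - a' + (b' - -a 1) = (a 0 + a 1 + a 2) - (a' - b') - a 2 := by abel
        _ = 0 := by rw [hsum, he]; abel)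
    subst hik
    exact Finset.mem_coe.2
      (Finset.mem_biUnion.2 ⟨i, Finset.mem_univ _, Finset.mem_product.2 ⟨hi, hk⟩⟩)
  · intro a ha a' ha' h
    obtain ⟨-, hs⟩ := Finset.mem_filter.1 (Finset.mem_coe.1 ha)
    obtain ⟨-, hs'⟩ := Finset.mem_filter.1 (Finset.mem_coe.1 ha')
    simp only [Prod.mk.injEq, neg_inj] at h
    rw [Fin.sum_univ_three] at hs hs'
    have h2 : a 2 = a' 2 := by
      have e := hs.trans hs'.symm
      rwa [h.1, h.2, add_left_cancel_iff] at e
    funext j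
    fin_cases j
    exacts [h.1, h.2, h2]

/-- **One block of the bookkeeping.** If every pair `(a, b) ∈ S ×ˢ T` has `a ∈ D₁`, `b ∈ D₂` or
`a - b ∈ R`, then `|S| |T| ≤ |T| |S ∩ D₁| + |S| |T ∩ D₂| + #{(a, b) ∈ S ×ˢ T : a - b ∈ R}`. -/
theorem card_mul_card_le_of_cover {G : Type*} [AddCommGroup G] [DecidableEq G]
    (S T D₁ D₂ R : Finset G) (h : ∀ a ∈ S, ∀ b ∈ T, a ∈ D₁ ∨ b ∈ D₂ ∨ a - b ∈ R) :
    S.card * T.card ≤ T.card * (S ∩ D₁).card + S.card * (T ∩ D₂).card +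
      ((S ×ˢ T).filter fun q : G × G => q.1 - q.2 ∈ R).card := by
  calc S.card * T.card = (S ×ˢ T).card := (Finset.card_product S T).symm
    _ ≤ ((S ∩ D₁) ×ˢ T ∪ S ×ˢ (T ∩ D₂) ∪
          (S ×ˢ T).filter fun q : G × G => q.1 - q.2 ∈ R).card := by
        refine Finset.card_le_card fun q hq => ?_
        have hq' := Finset.mem_product.1 hq
        rcases h q.1 hq'.1 q.2 hq'.2 with h1 | h2 | h3
        · exact Finset.mem_union_left _ (Finset.mem_union_left _
            (Finset.mem_product.2 ⟨Finset.mem_inter.2 ⟨hq'.1, h1⟩, hq'.2⟩))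
        · exact Finset.mem_union_left _ (Finset.mem_union_right _
            (Finset.mem_product.2 ⟨hq'.1, Finset.mem_inter.2 ⟨hq'.2, h2⟩⟩))
        · exact Finset.mem_union_right _ (Finset.mem_filter.2 ⟨hq, h3⟩)
    _ ≤ ((S ∩ D₁) ×ˢ T ∪ S ×ˢ (T ∩ D₂)).card +
          ((S ×ˢ T).filter fun q : G × G => q.1 - q.2 ∈ R).card := Finset.card_union_le _ _
    _ ≤ T.card * (S ∩ D₁).card + S.card * (T ∩ D₂).card +
          ((S ×ˢ T).filter fun q : G × G => q.1 - q.2 ∈ R).card := by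
        refine Nat.add_le_add_right ((Finset.card_union_le _ _).trans_eq ?_) _
        rw [Finset.card_product, Finset.card_product, Nat.mul_comm]

/-- **Disjoint blocks meet a set in at most its size.** If the `A i` are pairwise disjoint then
`Σᵢ |A i ∩ D| ≤ |D|`. -/
theorem sum_card_inter_le {ι G : Type*} [Fintype ι] [DecidableEq G] (A : ι → Finset G)
    (D : Finset G) (hA : ∀ i j, i ≠ j → Disjoint (A i) (A j)) :
    ∑ i, (A i ∩ D).card ≤ D.card := by
  have hdisj : (↑(Finset.univ : Finset ι) : Set ι).PairwiseDisjoint fun i => A i ∩ D :=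
    fun i _ j _ hij => (hA i j hij).mono Finset.inter_subset_left Finset.inter_subset_left
  rw [← Finset.card_biUnion hdisj]
  exact Finset.card_le_card (Finset.biUnion_subset.2 fun i _ => Finset.inter_subset_right)

/-- **The bookkeeping, in `ℕ`.** Let `A' 0 ⊆ X`, `A' 1 ⊆ -Y`, `A' 2 ⊆ -X₀` (any three sets, in
fact) carry no zero-sum triple, and put `R := -((-X₀) \ A' 2)`.  Every matched pair
`(a, b) ∈ A i ×ˢ B i` gives the zero-sum triple `(a, -b, -(a - b))` of `X ×ˢ (-Y) ×ˢ (-X₀)`, so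
`a ∈ X \ A' 0`, or `-b ∈ (-Y) \ A' 1`, or `a - b ∈ R`; summing the block inequalities
`card_mul_card_le_of_cover` over `i` and using that the `A i` (resp. `B i`) are pairwise disjoint
`s`-sets gives `n s² ≤ s |X \ A' 0| + s |(-Y) \ A' 1| + Σᵢ #{(a, b) ∈ A i ×ˢ B i : a - b ∈ R}`. -/
theorem mass_bound {G : Type*} [AddCommGroup G] [DecidableEq G] {n s : ℕ}
    (A B : Fin n → Finset G) (hcard : ∀ i : Fin n, (A i).card = s ∧ (B i).card = s)
    (hdA : ∀ i j : Fin n, i ≠ j → Disjoint (A i) (A j))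
    (hdB : ∀ i j : Fin n, i ≠ j → Disjoint (B i) (B j))
    (A' : Fin 3 → Finset G) (hno : ∀ a ∈ Fintype.piFinset A', ∑ j, a j ≠ 0) :
    n * (s * s) ≤ s * (Finset.univ.biUnion A \ A' 0).card +
      s * ((-(Finset.univ.biUnion B)) \ A' 1).card +
      ∑ i, ((A i ×ˢ B i).filter fun q : G × G =>
        q.1 - q.2 ∈ -((-(Finset.univ.biUnion fun i => A i - B i)) \ A' 2)).card := by
  set X := Finset.univ.biUnion A
  set Y := Finset.univ.biUnion B
  set X₀ := Finset.univ.biUnion fun i => A i - B i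
  set R := -((-X₀) \ A' 2)
  have htri : ∀ i, ∀ a ∈ A i, ∀ b ∈ B i, a ∈ X \ A' 0 ∨ b ∈ -((-Y) \ A' 1) ∨ a - b ∈ R := by
    intro i a ha b hb
    by_contra hne
    simp only [not_or] at hne
    obtain ⟨h1, h2, h3⟩ := hne
    have haX : a ∈ X := Finset.mem_biUnion.2 ⟨i, Finset.mem_univ _, ha⟩
    have hbY : -b ∈ -Y := by
      rw [Finset.mem_neg', neg_neg]
      exact Finset.mem_biUnion.2 ⟨i, Finset.mem_univ _, hb⟩
    have hdX : -(a - b) ∈ -X₀ := by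
      rw [Finset.mem_neg', neg_neg]
      exact Finset.mem_biUnion.2 ⟨i, Finset.mem_univ _, Finset.sub_mem_sub ha hb⟩
    have k0 : a ∈ A' 0 := by_contra fun hc => h1 (Finset.mem_sdiff.2 ⟨haX, hc⟩)
    have k1 : -b ∈ A' 1 :=
      by_contra fun hc => h2 (Finset.mem_neg'.2 (Finset.mem_sdiff.2 ⟨hbY, hc⟩))
    have k2 : -(a - b) ∈ A' 2 :=
      by_contra fun hc => h3 (Finset.mem_neg'.2 (Finset.mem_sdiff.2 ⟨hdX, hc⟩))
    refine hno ![a, -b, -(a - b)] (Fintype.mem_piFinset.2 fun j => ?_) ?_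
    · fin_cases j
      exacts [k0, k1, k2]
    · rw [Fin.sum_univ_three]
      show a + -b + -(a - b) = 0
      abel
  have hblock : ∀ i, s * s ≤ s * (A i ∩ (X \ A' 0)).card + s * (B i ∩ -((-Y) \ A' 1)).card +
      ((A i ×ˢ B i).filter fun q : G × G => q.1 - q.2 ∈ R).card := fun i => by
    have h := card_mul_card_le_of_cover (A i) (B i) (X \ A' 0) (-((-Y) \ A' 1)) R (htri i)
    rwa [(hcard i).1, (hcard i).2] at h
  have hsA := sum_card_inter_le A (X \ A' 0) hdA
  have hsB := sum_card_inter_le B (-((-Y) \ A' 1)) hdB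
  rw [Finset.card_neg] at hsB
  calc n * (s * s) = ∑ _i : Fin n, s * s := by
        rw [Finset.sum_const, Finset.card_univ, Fintype.card_fin, smul_eq_mul]
    _ ≤ ∑ i, (s * (A i ∩ (X \ A' 0)).card + s * (B i ∩ -((-Y) \ A' 1)).card +
          ((A i ×ˢ B i).filter fun q : G × G => q.1 - q.2 ∈ R).card) :=
        Finset.sum_le_sum fun i _ => hblock i
    _ = s * ∑ i, (A i ∩ (X \ A' 0)).card + s * ∑ i, (B i ∩ -((-Y) \ A' 1)).card +
          ∑ i, ((A i ×ˢ B i).filter fun q : G × G => q.1 - q.2 ∈ R).card := by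
        rw [Finset.sum_add_distrib, Finset.sum_add_distrib, Finset.mul_sum, Finset.mul_sum]
    _ ≤ s * (X \ A' 0).card + s * ((-Y) \ A' 1).card +
          ∑ i, ((A i ×ˢ B i).filter fun q : G × G => q.1 - q.2 ∈ R).card :=
        Nat.add_le_add_right
          (Nat.add_le_add (Nat.mul_le_mul_left s hsA) (Nat.mul_le_mul_left s hsB)) _

/-- **From `ℕ` to the real inequality of the statement.** -/
theorem real_bound_of_nat {n s M D₀ D₁ : ℕ} {η P : ℝ} (h : n * (s * s) ≤ s * D₀ + s * D₁ + M)
    (h0 : (D₀ : ℝ) ≤ η * P) (h1 : (D₁ : ℝ) ≤ η * P) :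
    (n : ℝ) * (s : ℝ) ^ 2 - 2 * η * P * (s : ℝ) ≤ (M : ℝ) := by
  have hR : ((n * (s * s) : ℕ) : ℝ) ≤ ((s * D₀ + s * D₁ + M : ℕ) : ℝ) := Nat.cast_le.2 h
  push_cast at hR
  have e0 := mul_le_mul_of_nonneg_left h0 (Nat.cast_nonneg s)
  have e1 := mul_le_mul_of_nonneg_left h1 (Nat.cast_nonneg s)
  have e : (n : ℝ) * (s : ℝ) ^ 2 - 2 * η * P * (s : ℝ) =
      n * (s * s) - (s * (η * P) + s * (η * P)) := by ring
  rw [e]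
  linarith

/-- **Mass concentration** (removal export): for every `η > 0` there is `s₀` such that every balanced SDPP
family `(A i, B i)_{i<n}` of `s`-sets in `ZMod p`, `s ≥ s₀`, has a set `R ⊆ X₀ = ⋃ (A i − B i)` of at most `η p`
private differences carrying all but `2 η p s` of the matched mass `n s²`. -/
theorem stub_massConcentration :
    ∀ η : ℝ, 0 < η → ∃ s₀ : ℕ, ∀ p : ℕ, p.Prime → ∀ (n s : ℕ) (A B : Fin n → Finset (ZMod p)),
    s₀ ≤ s → (∀ i : Fin n, (A i).card = s ∧ (B i).card = s) →
    (∀ i : Fin n, ∀ a ∈ A i, ∀ a' ∈ A i, ∀ b ∈ B i, ∀ b' ∈ B i, (a - a') + (b - b') = 0 → a = a' ∧ b = b') →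
    (∀ i j k : Fin n, ∀ a ∈ A i, ∀ a' ∈ A j, ∀ b ∈ B j, ∀ b' ∈ B k, (a - a') + (b - b') = 0 → i = k) →
    ∃ R : Finset (ZMod p), R ⊆ (Finset.univ.biUnion fun i => A i - B i) ∧ (R.card : ℝ) ≤ η * (p : ℝ) ∧
      (n : ℝ) * (s : ℝ) ^ 2 - 2 * η * (p : ℝ) * (s : ℝ) ≤
        ((∑ i, ((A i ×ˢ B i).filter fun q : ZMod p × ZMod p => q.1 - q.2 ∈ R).card : ℕ) : ℝ) := by
  intro η hη
  obtain ⟨δ, hδ, hrem⟩ := Literature.Combinatorics.Additive.Green2005_1_5_holds 3 le_rfl η hη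
  refine ⟨⌈1 / δ⌉₊ + 1, fun p hp n s A B hs hcard hW hX => ?_⟩
  haveI : NeZero p := ⟨hp.ne_zero⟩
  have hs1 : 1 ≤ s := le_trans (Nat.le_add_left 1 _) hs
  have hA : ∀ i, (A i).card = s := fun i => (hcard i).1
  have hB : ∀ i, (B i).card = s := fun i => (hcard i).2
  have hAne : ∀ i, (A i).Nonempty := fun i => Finset.card_pos.1 ((hA i).symm ▸ hs1)
  have hBne : ∀ i, (B i).Nonempty := fun i => Finset.card_pos.1 ((hB i).symm ▸ hs1)
  have hSD : Literature.Computability.AlgebraicComplexity.IsSDPP A B := ⟨hW, hX⟩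
  have hdA : ∀ i j : Fin n, i ≠ j → Disjoint (A i) (A j) := fun i j hij =>
    Literature.Computability.AlgebraicComplexity.disjoint_left_of_simultaneous hX hij (hBne j)
  have hdB : ∀ i j : Fin n, i ≠ j → Disjoint (B i) (B j) := fun i j hij =>
    Literature.Computability.AlgebraicComplexity.disjoint_right_of_simultaneous hX hij (hAne i)
  -- `n s ≤ p` (the `A i` are pairwise disjoint)
  have hns : n * s ≤ p := by
    have h := hSD.sum_card_left_le hBne
    simp only [hA, Finset.sum_const, Finset.card_univ, Fintype.card_fin, smul_eq_mul,
      ZMod.card] at h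
    exact h
  -- `n s² ≤ δ p²`
  have key : ((n * s : ℕ) : ℝ) * s ≤ p * (δ * p) := by
    rcases Nat.eq_zero_or_pos n with rfl | hn
    · simp only [zero_mul, Nat.cast_zero]
      exact mul_nonneg (Nat.cast_nonneg _) (mul_nonneg hδ.le (Nat.cast_nonneg _))
    · refine mul_le_mul (by exact_mod_cast hns) ?_ (Nat.cast_nonneg _) (Nat.cast_nonneg _)
      have hss : s * s ≤ p := by
        have h := Literature.Computability.AlgebraicComplexity.card_mul_card_le_of_dpp (hW ⟨0, hn⟩)
        rwa [hA, hB, ZMod.card] at h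
      have hδs : (1 : ℝ) ≤ δ * s := by
        have h1 : (⌈1 / δ⌉₊ : ℝ) + 1 ≤ s := by exact_mod_cast hs
        have h2 : 1 / δ ≤ (⌈1 / δ⌉₊ : ℝ) := Nat.le_ceil _
        have h3 : 1 / δ ≤ s := by linarith
        rw [div_le_iff₀ hδ] at h3
        linarith [mul_comm δ s]
      calc (s : ℝ) ≤ δ * s * s := le_mul_of_one_le_left (Nat.cast_nonneg _) hδs
        _ = δ * ((s * s : ℕ) : ℝ) := by push_cast; ring
        _ ≤ δ * p := mul_le_mul_of_nonneg_left (by exact_mod_cast hss) hδ.le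
  obtain ⟨A', -, hdel, hno⟩ := hrem (ZMod p)
    ![Finset.univ.biUnion A, -(Finset.univ.biUnion B), -(Finset.univ.biUnion fun i => A i - B i)]
    (by
      rw [ZMod.card]
      calc (_ : ℝ) ≤ ((∑ i, (A i).card * (B i).card : ℕ) : ℝ) :=
            Nat.cast_le.2 (card_solutions_le A B hX)
        _ = ((n * s : ℕ) : ℝ) * s := by
            simp only [hA, hB, Finset.sum_const, Finset.card_univ, Fintype.card_fin, smul_eq_mul]
            push_cast
            ring
        _ ≤ p * (δ * p) := key
        _ = δ * (p : ℝ) ^ (3 - 1) := by norm_num; ring)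
  have hd0 : (((Finset.univ.biUnion A \ A' 0).card : ℕ) : ℝ) ≤ η * p := by
    simpa only [ZMod.card, Matrix.cons_val] using hdel 0
  have hd1 : ((((-(Finset.univ.biUnion B)) \ A' 1).card : ℕ) : ℝ) ≤ η * p := by
    simpa only [ZMod.card, Matrix.cons_val] using hdel 1
  have hd2 : ((((-(Finset.univ.biUnion fun i => A i - B i)) \ A' 2).card : ℕ) : ℝ) ≤ η * p := by
    simpa only [ZMod.card, Matrix.cons_val] using hdel 2
  refine ⟨-((-(Finset.univ.biUnion fun i => A i - B i)) \ A' 2), fun r hr => ?_, ?_, ?_⟩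
  · rw [Finset.mem_neg'] at hr
    have h := (Finset.mem_sdiff.1 hr).1
    rwa [Finset.mem_neg', neg_neg] at h
  · rwa [Finset.card_neg]
  · exact real_bound_of_nat (mass_bound A B hcard hdA hdB A' hno) hd0 hd1

end Summit.MatrixMultiplication.MatrixMultiplication.Theorems.PrimeDensityDecay.MassConcentration
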